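import Mathlib.Analysis.Normed.Operator.Compact.Basic
import Mathlib.Analysis.Normed.Group.Quotient
import Mathlib.Analysis.Normed.Module.Completion
import Mathlib.Analysis.Seminorm
import Mathlib.Topology.Algebra.Module.FiniteDimension
import Mathlib.Topology.MetricSpace.Antilipschitz
import Mathlib.Topology.Sequences
import HarnessLib

/-!
# Peetre's lemma: an a priori estimate modulo a compact map forces finite-dimensional kernel
# and closed range

J. Peetre, *Another approach to elliptic boundary problems*, Comm. Pure Appl. Math. **14**
(1961), 711–731; recorded as **Peetre's lemma** in J.-L. Lions, E. Magenes, *Non-Homogeneous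
Boundary Value Problems and Applications I* (1972), Ch. 2, Lemma 5.1 — the locator is the one
printed by H. Sohr, *The Navier–Stokes Equations* (2001), Ch. II, end of the proof of Lemma 1.5.4
("The argument used here is well known, see Peetre's lemma [LiMa72, Chap. 2, Lemma 5.1]"; held
text), whose contradiction-and-compactness argument is the one formalised below.  The lemma:
*let `E`, `F`, `G` be Banach spaces, `E ⊂ F` with compact injection and `A ∈ L(E; G)`; then
`ker A` is finite-dimensional and `A(E)` is closed in `G` if (and only if) there is `C` with
`‖u‖_E ≤ C (‖A u‖_G + ‖u‖_F)` for all `u ∈ E`.*  It is the functional-analytic core of every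
finiteness theorem of elliptic theory (Gårding/elliptic estimate `+` Rellich compactness `⇒`
finite-dimensional harmonic space and closed range of the Laplacian; e.g. Warner, GTM 94,
proof of Thm. 6.8 from Thm. 6.6; Gilkey (1995), Lemma 1.4.5).

We prove the direction "estimate ⇒ finiteness", in a slightly more general form: over any
nontrivially normed field `𝕜`, for normed spaces `E`, `F`, `G`, a continuous linear
`A : E →L[𝕜] F`, and — in place of the compact injection — any continuous linear `K : E →L[𝕜] G`
that maps bounded sets to totally bounded sets (e.g. a compact operator,
`Peetre.totallyBounded_image_of_isCompactOperator`), under the estimate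
`∀ u, ‖u‖ ≤ C * (‖A u‖ + ‖K u‖)`:

* `Peetre.totallyBounded_closedBall_ker` — the unit ball of `ker A` is totally bounded (on
  `ker A` the estimate reads `‖u‖ ≤ C ‖K u‖`, so `K|_{ker A}` is uniformly inducing, and preimages
  of totally bounded sets under uniformly inducing maps are totally bounded);
* `Peetre.finiteDimensional_ker` — **`ker A` is finite-dimensional** (`𝕜` complete; Riesz:
  `FiniteDimensional.of_totallyBounded_nhds_zero`);
* `Peetre.exists_bound_norm_mk_le` — for `E` complete, the induced map `E ⧸ ker A → F` is bounded
  below: `‖[u]‖ ≤ c ‖A u‖` (Lions–Magenes' contradiction argument: a sequence with `‖[uₙ]‖`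
  pinned in a shell and `A uₙ → 0` has, by total boundedness of `K`(bounded set), a subsequence
  along which `K uₙ` is Cauchy, hence `uₙ` is Cauchy by the estimate, hence convergent to some
  `u ∈ ker A`, contradicting `‖[uₙ]‖ ≥ c₀ > 0`);
* `Peetre.isClosed_range` — **`A` has closed range** (`E` complete);
* `peetre` — both conclusions for a compact operator `K` (`IsCompactOperator K`).

Auxiliary, of independent use: `exists_subseq_cauchySeq_of_totallyBounded` (a sequence in a
totally bounded subset of a pseudometric space has a Cauchy subsequence, via the completion) and
`Peetre.cauchySeq_of_estimate`.

The converse direction of Lemma 5.1 ((i) ⇒ (ii), by the open mapping theorem) is not vendored.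
Everything is proved; there are no definitions and no named facts.

## References

* J. Peetre, Comm. Pure Appl. Math. 14 (1961), 711–731. [cite: Peetre1961]
* J.-L. Lions, E. Magenes, *Non-Homogeneous Boundary Value Problems and Applications I*,
  Grundlehren 181, Springer (1972), Ch. 2, Lemma 5.1. [cite: LionsMagenes1972, Ch. 2, Lemma 5.1]
* H. Sohr, *The Navier–Stokes Equations. An Elementary Functional Analytic Approach*,
  Birkhäuser (2001), Ch. II, Lemma 1.5.4 and its proof (held text, galaxy panama:319382358065218,
  chars 143500–150500). [cite: Sohr2001, Ch. II, Lemma 1.5.4]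
-/

open Filter Topology Set Metric Bornology

namespace Literature.Analysis.OperatorTheory

/-! ### A sequence in a totally bounded set has a Cauchy subsequence -/

/-- **A sequence in a totally bounded subset of a pseudometric space has a Cauchy subsequence**
(in the completion the closure of the image is compact, so a subsequence converges there, and
Cauchy-ness pulls back along the uniformly inducing embedding). [folklore] -/
theorem exists_subseq_cauchySeq_of_totallyBounded {X : Type*} [PseudoMetricSpace X] {s : Set X}
    (hs : TotallyBounded s) {x : ℕ → X} (hx : ∀ n, x n ∈ s) :
    ∃ φ : ℕ → ℕ, StrictMono φ ∧ CauchySeq (x ∘ φ) := by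
  let ι : X → UniformSpace.Completion X := (↑)
  have hι : IsUniformInducing ι := UniformSpace.Completion.isUniformInducing_coe X
  have htb : TotallyBounded (closure (ι '' s)) :=
    (hs.image (UniformSpace.Completion.uniformContinuous_coe X)).closure
  have hcpt : IsCompact (closure (ι '' s)) :=
    isCompact_iff_totallyBounded_isComplete.2 ⟨htb, isClosed_closure.isComplete⟩
  obtain ⟨a, -, φ, hφ, hlim⟩ :=
    hcpt.tendsto_subseq (x := ι ∘ x) fun n ↦ subset_closure ⟨x n, hx n, rfl⟩
  refine ⟨φ, hφ, ?_⟩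
  have hc : CauchySeq (ι ∘ x ∘ φ) := hlim.cauchySeq
  have hmap : map (ι ∘ x ∘ φ) atTop = map ι (map (x ∘ φ) atTop) := Filter.map_map.symm
  have hc' : Cauchy (map ι (map (x ∘ φ) atTop)) := by
    rw [← hmap]; exact hc
  exact (hι.cauchy_map_iff).1 hc'

namespace Peetre

variable {𝕜 : Type*} [NontriviallyNormedField 𝕜]
  {E : Type*} [NormedAddCommGroup E] [NormedSpace 𝕜 E]
  {F : Type*} [NormedAddCommGroup F] [NormedSpace 𝕜 F]
  {G : Type*} [NormedAddCommGroup G] [NormedSpace 𝕜 G]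
  {A : E →L[𝕜] F} {K : E →L[𝕜] G} {C : ℝ}

/-- A compact operator maps bounded sets to totally bounded sets (the form of compactness used in
Peetre's lemma; from `IsCompactOperator.isCompact_closure_image_of_bounded`). [folklore] -/
theorem totallyBounded_image_of_isCompactOperator (hK : IsCompactOperator K) {s : Set E}
    (hs : IsBounded s) : TotallyBounded (K '' s) :=
  (hK.isCompact_closure_image_of_bounded hs).totallyBounded.subset subset_closure

/-- On `ker A`, Peetre's estimate `‖u‖ ≤ C (‖A u‖ + ‖K u‖)` reads `‖u‖ ≤ C ‖K u‖` (we use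
`max C 0` to have a non-negative constant). [cite: LionsMagenes1972, Ch. 2, Lemma 5.1] -/
theorem norm_le_mul_norm_of_mem_ker (h : ∀ u, ‖u‖ ≤ C * (‖A u‖ + ‖K u‖)) {u : E}
    (hu : u ∈ LinearMap.ker (A : E →ₗ[𝕜] F)) : ‖u‖ ≤ max C 0 * ‖K u‖ := by
  have hAu : A u = 0 := LinearMap.mem_ker.1 hu
  calc ‖u‖ ≤ C * (‖A u‖ + ‖K u‖) := h u
    _ = C * ‖K u‖ := by rw [hAu, norm_zero, zero_add]
    _ ≤ max C 0 * ‖K u‖ := mul_le_mul_of_nonneg_right (le_max_left _ _) (norm_nonneg _)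

/-- **Two sequences' worth of Peetre's estimate**: if `(A uₙ)` and `(K uₙ)` are Cauchy then so is
`(uₙ)`, since `‖uₘ - uₙ‖ ≤ C (‖A uₘ - A uₙ‖ + ‖K uₘ - K uₙ‖)`.
[cite: LionsMagenes1972, Ch. 2, Lemma 5.1] -/
theorem cauchySeq_of_estimate (h : ∀ u, ‖u‖ ≤ C * (‖A u‖ + ‖K u‖)) {u : ℕ → E}
    (hA : CauchySeq (A ∘ u)) (hKu : CauchySeq (K ∘ u)) : CauchySeq u := by
  rw [Metric.cauchySeq_iff] at hA hKu ⊢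
  intro ε hε
  set C' : ℝ := max C 1 with hC'
  have hC'pos : 0 < C' := lt_of_lt_of_le one_pos (le_max_right _ _)
  have hδ : 0 < ε / (2 * C') := by positivity
  obtain ⟨N₁, hN₁⟩ := hA _ hδ
  obtain ⟨N₂, hN₂⟩ := hKu _ hδ
  refine ⟨max N₁ N₂, fun m hm n hn ↦ ?_⟩
  have hm₁ : N₁ ≤ m := le_of_max_le_left hm
  have hn₁ : N₁ ≤ n := le_of_max_le_left hn
  have hm₂ : N₂ ≤ m := le_of_max_le_right hm
  have hn₂ : N₂ ≤ n := le_of_max_le_right hn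
  have h1 : ‖A (u m) - A (u n)‖ < ε / (2 * C') := by
    simpa [dist_eq_norm] using hN₁ m hm₁ n hn₁
  have h2 : ‖K (u m) - K (u n)‖ < ε / (2 * C') := by
    simpa [dist_eq_norm] using hN₂ m hm₂ n hn₂
  have hsum_nonneg : 0 ≤ ‖A (u m - u n)‖ + ‖K (u m - u n)‖ := by positivity
  calc dist (u m) (u n) = ‖u m - u n‖ := dist_eq_norm _ _
    _ ≤ C * (‖A (u m - u n)‖ + ‖K (u m - u n)‖) := h _
    _ ≤ C' * (‖A (u m - u n)‖ + ‖K (u m - u n)‖) :=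
        mul_le_mul_of_nonneg_right (le_max_left _ _) hsum_nonneg
    _ < C' * (ε / (2 * C') + ε / (2 * C')) := by
        rw [map_sub, map_sub]
        gcongr
    _ = ε := by field_simp; ring

/-- **The unit ball of `ker A` is totally bounded** under Peetre's estimate, when `K` maps
bounded sets to totally bounded sets: on `ker A` the estimate gives `‖u‖ ≤ C ‖K u‖`, so the
restriction of `K` to `ker A` is antilipschitz, hence uniformly inducing, and the unit ball of
`ker A` lies in the preimage of the totally bounded set `K(B_E(0,1))`.
[cite: LionsMagenes1972, Ch. 2, Lemma 5.1] -/
theorem totallyBounded_closedBall_ker (h : ∀ u, ‖u‖ ≤ C * (‖A u‖ + ‖K u‖))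
    (hK : ∀ ⦃s : Set E⦄, IsBounded s → TotallyBounded (K '' s)) :
    TotallyBounded (closedBall (0 : LinearMap.ker (A : E →ₗ[𝕜] F)) 1) := by
  set Kk : LinearMap.ker (A : E →ₗ[𝕜] F) →L[𝕜] G := K.comp (LinearMap.ker (A : E →ₗ[𝕜] F)).subtypeL with hKk
  have hanti : AntilipschitzWith ⟨max C 0, le_max_right _ _⟩ Kk := by
    refine Kk.antilipschitz_of_bound fun u ↦ ?_
    change ‖u‖ ≤ max C 0 * ‖Kk u‖
    simpa [hKk] using norm_le_mul_norm_of_mem_ker h u.2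
  have hui : IsUniformInducing Kk := hanti.isUniformInducing Kk.uniformContinuous
  have hsub : closedBall (0 : LinearMap.ker (A : E →ₗ[𝕜] F)) 1 ⊆ Kk ⁻¹' (K '' closedBall (0 : E) 1) := by
    intro u hu
    refine ⟨(u : E), ?_, rfl⟩
    simpa using hu
  exact (totallyBounded_preimage hui (hK isBounded_closedBall)).subset hsub

/-- **Peetre's lemma, kernel part: `ker A` is finite-dimensional** (Lions–Magenes (1972), Ch. 2,
Lemma 5.1, (ii) ⇒ (i), first half): if `‖u‖ ≤ C (‖A u‖ + ‖K u‖)` for all `u`, with `K` mapping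
bounded sets to totally bounded sets, then the unit ball of `ker A` is totally bounded
(`totallyBounded_closedBall_ker`), so `ker A` is finite-dimensional by F. Riesz's theorem
(`FiniteDimensional.of_totallyBounded_nhds_zero`; `𝕜` complete). No completeness of `E`, `F`,
`G` is needed for this half. [cite: LionsMagenes1972, Ch. 2, Lemma 5.1] -/
theorem finiteDimensional_ker [CompleteSpace 𝕜] (h : ∀ u, ‖u‖ ≤ C * (‖A u‖ + ‖K u‖))
    (hK : ∀ ⦃s : Set E⦄, IsBounded s → TotallyBounded (K '' s)) :
    FiniteDimensional 𝕜 (LinearMap.ker (A : E →ₗ[𝕜] F)) :=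
  FiniteDimensional.of_totallyBounded_nhds_zero 𝕜
    (closedBall_mem_nhds (0 : LinearMap.ker (A : E →ₗ[𝕜] F)) one_pos) (totallyBounded_closedBall_ker h hK)

/-- **Peetre's lemma, the induced map `E ⧸ ker A → F` is bounded below** (Lions–Magenes (1972),
Ch. 2, Lemma 5.1, the contradiction argument; Sohr (2001), proof of Lemma II.1.5.4): for `E`
complete, under Peetre's estimate with `K` mapping bounded sets to totally bounded sets, there is
`c` with `‖[u]‖_{E ⧸ ker A} ≤ c ‖A u‖` for all `u`.  Proof: otherwise there are `uₙ` with
`‖[uₙ]‖` in a fixed shell `[c₀, 1]`, `‖uₙ‖ < 2` and `A uₙ → 0`; along a subsequence `K uₙ` is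
Cauchy (`exists_subseq_cauchySeq_of_totallyBounded`), hence `uₙ` is Cauchy
(`cauchySeq_of_estimate`), `uₙ → u`, `A u = 0`, so `[uₙ] → [u] = 0`, contradicting
`‖[uₙ]‖ ≥ c₀ > 0`. (Over a general nontrivially normed field one cannot normalise to `‖[uₙ]‖ = 1`;
a shell `[c₀, 1]` from `rescale_to_shell` suffices.) [cite: LionsMagenes1972, Ch. 2, Lemma 5.1] -/
theorem exists_bound_norm_mk_le [CompleteSpace E] (h : ∀ u, ‖u‖ ≤ C * (‖A u‖ + ‖K u‖))
    (hK : ∀ ⦃s : Set E⦄, IsBounded s → TotallyBounded (K '' s)) :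
    ∃ c : ℝ, ∀ u : E, ‖(Submodule.Quotient.mk u : E ⧸ LinearMap.ker (A : E →ₗ[𝕜] F))‖ ≤ c * ‖A u‖ := by
  classical
  set N : Submodule 𝕜 E := LinearMap.ker (A : E →ₗ[𝕜] F) with hN
  by_contra! hcon
  -- Step 1: a shell: for every `ε > 0` some `u` with `‖[u]‖ ≤ 1`, `c₀ ≤ ‖[u]‖`, `‖A u‖ < ε`.
  obtain ⟨d, hd⟩ := NormedField.exists_one_lt_norm 𝕜
  have hc₀ : 0 < ‖d‖⁻¹ := by positivity
  have shell : ∀ ε > 0, ∃ u : E, ‖(Submodule.Quotient.mk u : E ⧸ N)‖ ≤ 1 ∧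
      ‖d‖⁻¹ ≤ ‖(Submodule.Quotient.mk u : E ⧸ N)‖ ∧ ‖A u‖ < ε := by
    intro ε hε
    -- from `hcon` with the constant `ε⁻¹`: some `u` with `ε⁻¹ * ‖A u‖ < ‖[u]‖`
    obtain ⟨u, hu⟩ := hcon ε⁻¹
    have hq0 : ‖(Submodule.Quotient.mk u : E ⧸ N)‖ ≠ 0 :=
      (lt_of_le_of_lt (by positivity) hu).ne'
    obtain ⟨η, hη, h₁, h₂, -⟩ := rescale_to_shell_semi_normed hd one_pos hq0
    refine ⟨η • u, ?_, ?_, ?_⟩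
    · simpa [Submodule.Quotient.mk_smul] using h₁.le
    · simpa [Submodule.Quotient.mk_smul] using h₂
    · -- `‖A (η • u)‖ = ‖η‖ ‖A u‖ < ‖η‖ * ε * ‖[u]‖ ≤ ε` since `‖η‖ ‖[u]‖ = ‖[η • u]‖ < 1`
      have hAu : ‖A u‖ < ε * ‖(Submodule.Quotient.mk u : E ⧸ N)‖ := by
        have := mul_lt_mul_of_pos_left hu hε
        rwa [← mul_assoc, mul_inv_cancel₀ hε.ne', one_mul] at this
      have hηpos : 0 < ‖η‖ := norm_pos_iff.2 hη
      have hnorm : ‖η‖ * ‖(Submodule.Quotient.mk u : E ⧸ N)‖ < 1 := by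
        have : ‖(Submodule.Quotient.mk (η • u) : E ⧸ N)‖ = ‖η‖ * ‖(Submodule.Quotient.mk u : E ⧸ N)‖ := by
          rw [Submodule.Quotient.mk_smul, norm_smul]
        rw [← this]; exact h₁
      calc ‖A (η • u)‖ = ‖η‖ * ‖A u‖ := by rw [map_smul, norm_smul]
        _ < ‖η‖ * (ε * ‖(Submodule.Quotient.mk u : E ⧸ N)‖) := mul_lt_mul_of_pos_left hAu hηpos
        _ = ε * (‖η‖ * ‖(Submodule.Quotient.mk u : E ⧸ N)‖) := by ring
        _ ≤ ε * 1 := mul_le_mul_of_nonneg_left hnorm.le hε.le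
        _ = ε := mul_one ε
  -- Step 2: the sequence, with representatives of norm `< 2`.
  have hseq : ∀ n : ℕ, ∃ u : E, ‖u‖ < 2 ∧ ‖d‖⁻¹ ≤ ‖(Submodule.Quotient.mk u : E ⧸ N)‖ ∧
      ‖A u‖ < 1 / ((n : ℝ) + 1) := by
    intro n
    obtain ⟨u, hu1, hu2, hu3⟩ := shell (1 / ((n : ℝ) + 1)) (by positivity)
    obtain ⟨m, hm, hmlt⟩ := Submodule.Quotient.norm_mk_lt (Submodule.Quotient.mk u : E ⧸ N) one_pos
    -- `m - u ∈ N = ker A`, so `A m = A u`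
    have hmu : m - u ∈ N := by
      rw [← Submodule.Quotient.eq]; exact hm
    have hAm : A m = A u := by
      have : A (m - u) = 0 := hmu
      rwa [map_sub, sub_eq_zero] at this
    refine ⟨m, ?_, ?_, ?_⟩
    · linarith
    · rwa [hm]
    · rwa [hAm]
  choose u hu_norm hu_shell hu_A using hseq
  -- Step 3: a subsequence along which `K uₙ` is Cauchy.
  have hKtb : TotallyBounded (K '' ball (0 : E) 2) := hK isBounded_ball
  obtain ⟨φ, hφ, hKc⟩ := exists_subseq_cauchySeq_of_totallyBounded hKtb (x := fun n ↦ K (u n))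
    fun n ↦ ⟨u n, by simpa using hu_norm n, rfl⟩
  -- `A (u (φ n)) → 0`
  have hA0 : Tendsto (fun n ↦ A (u (φ n))) atTop (𝓝 0) := by
    rw [tendsto_zero_iff_norm_tendsto_zero]
    have hle : ∀ n, ‖A (u (φ n))‖ ≤ 1 / ((n : ℝ) + 1) := fun n ↦ by
      refine (hu_A (φ n)).le.trans ?_
      gcongr
      exact_mod_cast hφ.id_le n
    exact squeeze_zero (fun n ↦ norm_nonneg _) hle tendsto_one_div_add_atTop_nhds_zero_nat
  have hAc : CauchySeq (A ∘ u ∘ φ) := hA0.cauchySeq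
  -- Step 4: `u ∘ φ` is Cauchy, hence convergent; the limit lies in `ker A`.
  have huc : CauchySeq (u ∘ φ) := cauchySeq_of_estimate h hAc hKc
  obtain ⟨w, hw⟩ := cauchySeq_tendsto_of_complete huc
  have hAw : A w = 0 := by
    have h1 : Tendsto (fun n ↦ A (u (φ n))) atTop (𝓝 (A w)) := (A.continuous.tendsto w).comp hw
    exact tendsto_nhds_unique h1 hA0
  have hw0 : (Submodule.Quotient.mk w : E ⧸ N) = 0 := (Submodule.Quotient.mk_eq_zero N).2 hAw
  -- Step 5: `[u (φ n)] → [w] = 0`, contradicting the shell.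
  have hmk_cont : Continuous (Submodule.Quotient.mk : E → E ⧸ N) :=
    AddMonoidHomClass.continuous_of_bound N.mkQ 1 fun x ↦ by
      simpa using Submodule.Quotient.norm_mk_le N x
  have hlim : Tendsto (fun n ↦ ‖(Submodule.Quotient.mk (u (φ n)) : E ⧸ N)‖) atTop (𝓝 0) := by
    have := ((hmk_cont.tendsto w).comp hw).norm
    rwa [hw0, norm_zero] at this
  have hge : ∀ n, ‖d‖⁻¹ ≤ ‖(Submodule.Quotient.mk (u (φ n)) : E ⧸ N)‖ := fun n ↦ hu_shell (φ n)
  have : ‖d‖⁻¹ ≤ 0 := ge_of_tendsto' hlim hge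
  exact absurd this (not_le.2 hc₀)

/-- **Peetre's lemma, range part: `A` has closed range** (Lions–Magenes (1972), Ch. 2, Lemma 5.1,
(ii) ⇒ (i), second half): for `E` complete, under the estimate `‖u‖ ≤ C (‖A u‖ + ‖K u‖)` with
`K` mapping bounded sets to totally bounded sets, `A(E)` is closed in `F`. The induced injection
`E ⧸ ker A → F` is bounded below (`exists_bound_norm_mk_le`) on the complete space `E ⧸ ker A`,
hence has closed range, and its range is `A(E)`. [cite: LionsMagenes1972, Ch. 2, Lemma 5.1] -/
theorem isClosed_range [CompleteSpace E] (h : ∀ u, ‖u‖ ≤ C * (‖A u‖ + ‖K u‖))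
    (hK : ∀ ⦃s : Set E⦄, IsBounded s → TotallyBounded (K '' s)) :
    IsClosed (Set.range A) := by
  set N : Submodule 𝕜 E := LinearMap.ker (A : E →ₗ[𝕜] F) with hN
  haveI : IsClosed (N : Set E) := A.isClosed_ker
  obtain ⟨c, hc⟩ := exists_bound_norm_mk_le h hK
  -- the induced continuous linear map on the quotient
  let Aqₗ : (E ⧸ N) →ₗ[𝕜] F := N.liftQ (A : E →ₗ[𝕜] F) le_rfl
  have hAq_mk : ∀ u : E, Aqₗ (Submodule.Quotient.mk u) = A u := fun u ↦ rfl
  have hbound : ∀ q : E ⧸ N, ‖Aqₗ q‖ ≤ ‖A‖ * ‖q‖ := by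
    intro q
    refine le_of_forall_pos_lt_add fun ε hε ↦ ?_
    have hA1 : 0 < ‖A‖ + 1 := by positivity
    obtain ⟨m, hm, hmlt⟩ := Submodule.Quotient.norm_mk_lt q (div_pos hε hA1)
    rw [← hm, hAq_mk]
    calc ‖A m‖ ≤ ‖A‖ * ‖m‖ := A.le_opNorm m
      _ ≤ ‖A‖ * (‖q‖ + ε / (‖A‖ + 1)) := mul_le_mul_of_nonneg_left hmlt.le (norm_nonneg _)
      _ = ‖A‖ * ‖q‖ + ‖A‖ / (‖A‖ + 1) * ε := by ring
      _ < ‖A‖ * ‖q‖ + 1 * ε := by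
          gcongr
          rw [div_lt_one hA1]; exact lt_add_one _
      _ = ‖A‖ * ‖(Submodule.Quotient.mk m : E ⧸ N)‖ + ε := by rw [one_mul, hm]
  let Aq : (E ⧸ N) →L[𝕜] F := Aqₗ.mkContinuous ‖A‖ hbound
  -- bounded below
  have hanti : AntilipschitzWith ⟨max c 0, le_max_right _ _⟩ Aq := by
    refine Aq.antilipschitz_of_bound fun q ↦ ?_
    obtain ⟨u, rfl⟩ := Submodule.Quotient.mk_surjective N q
    change ‖(Submodule.Quotient.mk u : E ⧸ N)‖ ≤ max c 0 * ‖Aqₗ (Submodule.Quotient.mk u)‖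
    rw [hAq_mk]
    exact (hc u).trans (mul_le_mul_of_nonneg_right (le_max_left _ _) (norm_nonneg _))
  have hclosed : IsClosed (Set.range Aq) := hanti.isClosed_range Aq.uniformContinuous
  -- same range
  have hrange : Set.range Aq = Set.range A := by
    ext y
    constructor
    · rintro ⟨q, rfl⟩
      obtain ⟨u, rfl⟩ := Submodule.Quotient.mk_surjective N q
      exact ⟨u, (hAq_mk u).symm⟩
    · rintro ⟨u, rfl⟩
      exact ⟨Submodule.Quotient.mk u, hAq_mk u⟩
  rwa [hrange] at hclosed

end Peetre

/-- **Peetre's lemma** (Peetre (1961); Lions–Magenes (1972), Ch. 2, Lemma 5.1, direction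
(ii) ⇒ (i), with the compact injection `E ⊂ F` replaced by an arbitrary compact linear map `K`):
let `E` be a Banach space and `F`, `G` normed spaces over a complete nontrivially normed field,
`A : E →L F` continuous linear and `K : E →L G` a compact operator. If there is a constant `C`
with `‖u‖ ≤ C (‖A u‖ + ‖K u‖)` for all `u ∈ E`, then `ker A` is finite-dimensional and `A` has
closed range. [cite: LionsMagenes1972, Ch. 2, Lemma 5.1] [cite: Peetre1961] -/
theorem peetre {𝕜 : Type*} [NontriviallyNormedField 𝕜] [CompleteSpace 𝕜]
    {E : Type*} [NormedAddCommGroup E] [NormedSpace 𝕜 E] [CompleteSpace E]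
    {F : Type*} [NormedAddCommGroup F] [NormedSpace 𝕜 F]
    {G : Type*} [NormedAddCommGroup G] [NormedSpace 𝕜 G]
    (A : E →L[𝕜] F) {K : E →L[𝕜] G} (hK : IsCompactOperator K) {C : ℝ}
    (h : ∀ u, ‖u‖ ≤ C * (‖A u‖ + ‖K u‖)) :
    FiniteDimensional 𝕜 (LinearMap.ker (A : E →ₗ[𝕜] F)) ∧ IsClosed (Set.range A) :=
  ⟨Peetre.finiteDimensional_ker h fun _ hs ↦ Peetre.totallyBounded_image_of_isCompactOperator hK hs,
    Peetre.isClosed_range h fun _ hs ↦ Peetre.totallyBounded_image_of_isCompactOperator hK hs⟩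

end Literature.Analysis.OperatorTheory
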